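/-
Origin: expansion seat `planner-pub-hodgecm-pv13-g3-0`, handover #10 v2 2026-08-18T07:44:38Z (`HOME/pub-hodgecm-pv13-g3/lean/Pv13g3/IdentificationEnd.lean`, md5 0c425e36, 183 lines);
landed by the gen-7 packager in gate run 26 as `HodgeCM/PerL34/IdentificationEnd.lean` (import ^import Pv13g3\.→import HodgeCM.PerL34. ×1).
-/
/-
Copyright: HodgeCM publication cell (pub-hodgecm), DAG node N31h (seam S3) — the headline of #9 with the D4
IDENTIFICATION at the split unramified places in its PRINT SHAPE.  Prover seat pv13-g3 (DAG-NODE PROVER #13,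
generation 3), file #10.  Released under the package licence.

# `Θ(χ′) ≠ 0` — split unramified places entered through `τ_v : U(W_i)(L_{0,v}) ≅ L_{0,v}^×` with `τ_v(K_v) = 𝒪_v^×`

Text under adjudication (NOT cited), PerL v5 l. 610 "If `v` splits in `L/L₀` then `U(W_i)(L_{0,v}) ≅ L_{0,v}^×`" and
l. 628 "`K_v`-fixed / unramified": the identification of the local group with the multiplicative group of the
completion, matching the level `K_v = B_v` with the unit group `𝒪_v^×`.  In #4–#9 this entered at a split place
`v ∉ S` as FOUR data / hypotheses (`ord_v : G_v →* ℤ`, `ϖ_v`, `ord_v ϖ_v = 1`, `ker ord_v = B_v`) plus the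
intertwiner's homomorphism `t_v` with `t_v ϖ_v = ϖF_v`, next to the uniformizer `ϖF_v` itself.  Here all of them are
DERIVED from the print datum: a group isomorphism `τ_v : G_v ≃* L_{0,v}^×` with `g ∈ B_v ↔ |τ_v g| = 1`, via pv07-g2's
`exists_isUniformizer` and the valuation `IsUniformizer.ord` (`DilationOrd`, run 25): `ϖF_v` chosen,
`ord_v := ord_{ϖF_v} ∘ τ_v`, `ϖ_v := τ_v⁻¹ ϖF_v`, `t_v := τ_v`.
Complete proofs; axioms = the standard trio.
-/
import Summits.HodgeConjecture.HodgeCM.PerL34.IntertwinerEnd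

noncomputable section

open MeasureTheory MeasureTheory.Measure Set Metric Function Complex ComplexConjugate
open scoped RestrictedProduct InnerProductSpace NNReal ENNReal

namespace HodgeCM.PerL34.SplitShells

open HodgeCM.PerL34.PureTensor HodgeCM.PerL34.AdelicFactorisation HodgeCM.PerL34.RestrictedMeasure
open HodgeCM.PerL34.NoSmallSubgroups HodgeCM.PerL34.EulerFactorisation
open HodgeCM.PerL34.LocalFactors HodgeCM.PerL34.LocalFactors.DilationModel
open HodgeCM.PerL34.LocalModulus HodgeCM.PerL34.SplitPlaceDilation
open HodgeCM.PerL34.RallisIP HodgeCM.PerL34.Doubling HodgeCM.PerL34.N31d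

attribute [local instance] LocalFactors.DilationModel.Adic.nontriviallyNormedField
  LocalFactors.DilationModel.Adic.properSpace

/-! ## §1 `ord_v`, `ϖ_v` from the identification `τ_v` -/

section ident

variable {ι : Type} {G : ι → Type} [∀ i, CommGroup (G i)] (B : ∀ i, Subgroup (G i)) (S : Finset ι)
  (IsSplit : ι → Prop) (L₀ : Type) [Field L₀] [NumberField L₀]
  (w : ι → IsDedekindDomain.HeightOneSpectrum (NumberField.RingOfIntegers L₀))
  (ϖF : ∀ i, ((w i).adicCompletion L₀)ˣ) (hϖF : ∀ i, i ∉ S → IsUniformizer (ϖF i))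
  (τU : ∀ i, i ∉ S → IsSplit i → (G i ≃* ((w i).adicCompletion L₀)ˣ))
  (hτUB : ∀ i (hi : i ∉ S) (hs : IsSplit i), ∀ g : G i,
    g ∈ B i ↔ ‖((τU i hi hs g : ((w i).adicCompletion L₀)ˣ) : (w i).adicCompletion L₀)‖ = 1)

open scoped Classical in
/-- `ord_v := ord_{ϖF_v} ∘ τ_v` at a split place `v ∉ S` (the trivial homomorphism elsewhere — never used there). -/
def ordOfIdent (i : ι) : G i →* Multiplicative ℤ :=
  if h : i ∉ S ∧ IsSplit i then ((hϖF i h.1).ord).comp (τU i h.1 h.2).toMonoidHom else 1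

open scoped Classical in
/-- `ϖ_v := τ_v⁻¹ ϖF_v` at a split place `v ∉ S` (`1` elsewhere — never used there). -/
def unifOfIdent (i : ι) : G i := if h : i ∉ S ∧ IsSplit i then (τU i h.1 h.2).symm (ϖF i) else 1

/-- (Ported verbatim from the HodgeCMPerL package; no docstring in the source.) -/
theorem ordOfIdent_apply {i : ι} (hi : i ∉ S) (hs : IsSplit i) (g : G i) :
    ordOfIdent S IsSplit L₀ w ϖF hϖF τU i g = (hϖF i hi).ord (τU i hi hs g) := by
  classical
  simp only [ordOfIdent, dif_pos (And.intro hi hs), MonoidHom.comp_apply, MulEquiv.coe_toMonoidHom]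

/-- (Ported verbatim from the HodgeCMPerL package; no docstring in the source.) -/
theorem unifOfIdent_eq {i : ι} (hi : i ∉ S) (hs : IsSplit i) :
    unifOfIdent S IsSplit L₀ w ϖF τU i = (τU i hi hs).symm (ϖF i) := by
  classical
  simp only [unifOfIdent, dif_pos (And.intro hi hs)]

/-- `τ_v ϖ_v = ϖF_v` (the intertwiner's `htU`). -/
theorem τU_unifOfIdent (i : ι) (hi : i ∉ S) (hs : IsSplit i) :
    (τU i hi hs).toMonoidHom (unifOfIdent S IsSplit L₀ w ϖF τU i) = ϖF i := by
  rw [unifOfIdent_eq S IsSplit L₀ w ϖF τU hi hs, MulEquiv.coe_toMonoidHom, MulEquiv.apply_symm_apply]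

/-- `ord_v ϖ_v = 1` (binder `ord_ϖ`). -/
theorem ordOfIdent_unif (i : ι) (hi : i ∉ S) (hs : IsSplit i) :
    ordOfIdent S IsSplit L₀ w ϖF hϖF τU i (unifOfIdent S IsSplit L₀ w ϖF τU i) = Multiplicative.ofAdd 1 := by
  rw [ordOfIdent_apply S IsSplit L₀ w ϖF hϖF τU hi hs, unifOfIdent_eq S IsSplit L₀ w ϖF τU hi hs,
    MulEquiv.apply_symm_apply, (hϖF i hi).ord_self]

include hτUB in
/-- `ker ord_v = B_v` (binder `ker_ord`), from `τ_v(B_v) = 𝒪_v^×`. -/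
theorem ordOfIdent_eq_one_iff (i : ι) (hi : i ∉ S) (hs : IsSplit i) (g : G i) :
    ordOfIdent S IsSplit L₀ w ϖF hϖF τU i g = 1 ↔ g ∈ B i := by
  rw [ordOfIdent_apply S IsSplit L₀ w ϖF hϖF τU hi hs, (hϖF i hi).ord_eq_one_iff, hτUB i hi hs]

end ident

/-! ## §2 The headline with the identification in print shape -/

section identEnd

variable {ι : Type} {G : ι → Type} [∀ i, CommGroup (G i)] [∀ i, TopologicalSpace (G i)]
  [∀ i, IsTopologicalGroup (G i)] [∀ i, T2Space (G i)] [∀ i, SecondCountableTopology (G i)]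
  [∀ i, LocallyCompactSpace (G i)] [∀ i, MeasurableSpace (G i)] [∀ i, BorelSpace (G i)]
  [Countable ι] [DecidableEq ι]
  (B : ∀ i, Subgroup (G i)) (hBc : ∀ i, IsCompact (B i : Set (G i)))
  (hBo : ∀ i, IsOpen (B i : Set (G i))) (S₀ : Finset ι)
  {Sp : Type} [NormedAddCommGroup Sp] [InnerProductSpace ℂ Sp]
  {L : Type} [Field L] [StarRing L] {W : Type} [AddCommGroup W] [Module L W]
  {H Sbox : Type} [Group H] [AddCommGroup Sbox] [Module ℂ Sbox]
  {h : W →ₗ⋆[L] W →ₗ[L] L} (hW : IsLine L W) (hh : Anisotropic h)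
  (D : DoublingDatum (Πʳ j, [G j, B j]) H Sp Sbox) (GU : ThetaSide Sp Sbox)
  [Countable (unitary L)] (jA : unitary L →* Πʳ j, [G j, B j]) (hjA : Function.Injective jA)
  (j : isomBox h →* H) (hj : ∀ d : unitary L, j ⟨iotaSnd d, iotaSnd_mem h d⟩ = D.ι (1, jA d))
  {𝓕 : Set (Πʳ j, [G j, B j])} (h𝓕 : IsFundamentalDomain jA.range 𝓕 (haarDatum B hBc hBo S₀).μ)
  (χ : (Πʳ j, [G j, B j]) →* Circle) (hχΓ : ∀ d : unitary L, χ (jA d) = 1)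
  (hχVΓ : ∀ d : unitary L, D.χV (jA d) = 1)
  {hP : ∀ Ψ : Sbox, ∀ p ∈ (stabDelta L W).subgroupOf (isomBox h), ∀ x : H,
    D.fSW Ψ (j p * x) = D.fSW Ψ x}
  (P : GluePrintInputs D GU h j hP) (φ : Sp) (hφ : ‖φ‖ = 1)
  (hloc : ∀ (i : ι) (v : Sp), Continuous fun g : G i => D.ω (RestrictedProduct.mulSingle B i g) v)
  {T' : Finset ι} (hχT' : RestrictedProduct.boxSubgroup B T' ≤ χ.ker)
  (hlocχ : ∀ i ∈ T', Continuous fun g : G i => χ (RestrictedProduct.mulSingle B i g))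
  {T : Finset ι} (hK : ∀ k ∈ RestrictedProduct.boxSubgroup B T, D.ω k φ = φ)
  (hM : ∀ S : Finset ι, T ⊆ S → ∀ y : (i : ↥S) → G i,
    inner ℂ φ (D.ω (extendOne B S y) φ) = ∏ i : ↥S, localCoeff B D.ω φ i (y i))
  {S : Finset ι} {IsSplit : ι → Prop} (hTS : T ⊆ S) (hT'S : T' ⊆ S)
  (L₀ : Type) [Field L₀] [NumberField L₀]
  (w : ι → IsDedekindDomain.HeightOneSpectrum (NumberField.RingOfIntegers L₀))
  (hw : ∀ ⦃i j : ι⦄, i ∉ S → j ∉ S → w i = w j → i = j)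
  [∀ i, MeasurableSpace ((w i).adicCompletion L₀)] [∀ i, BorelSpace ((w i).adicCompletion L₀)]
  (ν : ∀ i, ((w i).adicCompletion L₀)ˣ →* Circle)
  (hBi : ∀ i, i ∉ S → ¬IsSplit i → (B i : Set (G i)) = Set.univ)
  -- `v ∉ S` split: the IDENTIFICATION `τ_v` with `τ_v(B_v) = 𝒪_v^×` (D4, l. 610/628), `ν_v` unramified, and the
  -- INTERTWINER on `1_{𝒪_v³}` along `τ_v` (a uniformizer `ϖF_v` is CHOSEN in the proof: pv07-g2 `exists_isUniformizer`)
  (τU : ∀ i, i ∉ S → IsSplit i → (G i ≃* ((w i).adicCompletion L₀)ˣ))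
  (hτUB : ∀ i (hi : i ∉ S) (hs : IsSplit i), ∀ g : G i,
    g ∈ B i ↔ ‖((τU i hi hs g : ((w i).adicCompletion L₀)ˣ) : (w i).adicCompletion L₀)‖ = 1)
  (hν : ∀ i, i ∉ S → IsSplit i → ∀ u : ((w i).adicCompletion L₀)ˣ,
    ‖(u : (w i).adicCompletion L₀)‖ = 1 → ν i u = 1)
  (VU : ∀ i, i ∉ S → IsSplit i → (Lp ℂ 2 (Adic.muV L₀ (w i)) →ₗᵢ[ℂ] Sp))
  (hVUψ : ∀ i (hi : i ∉ S) (hs : IsSplit i), VU i hi hs (ballIndicator (Adic.muV L₀ (w i)) 0 1) = φ)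
  (hVU : ∀ i (hi : i ∉ S) (hs : IsSplit i), ∀ g : G i,
    D.ω (RestrictedProduct.mulSingle B i g) (VU i hi hs (ballIndicator (Adic.muV L₀ (w i)) 0 1))
      = VU i hi hs (dilationRep (Adic.muV L₀ (w i)) (ν i) (τU i hi hs g) (ballIndicator (Adic.muV L₀ (w i)) 0 1)))
  -- `v ∈ S` split: as #9
  (τ : ∀ i, i ∈ S → IsSplit i → (G i ≃ₜ* ((w i).adicCompletion L₀)ˣ))
  (x₀ : ∀ i, Fin 3 → (w i).adicCompletion L₀) (r : ι → ℝ) (a : ι → ℂ)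
  (hr : ∀ i ∈ S, IsSplit i → r i < ‖x₀ i‖) (hr0 : ∀ i ∈ S, IsSplit i → 0 < r i)
  (hνS : ∀ i ∈ S, IsSplit i → ∀ y : ((w i).adicCompletion L₀)ˣ,
    (y : (w i).adicCompletion L₀) ∈ U1 (x₀ i) (r i) → ν i y = 1)
  (hχS : ∀ i (hi : i ∈ S) (hs : IsSplit i), ∀ g : G i,
    ((τ i hi hs g : ((w i).adicCompletion L₀)ˣ) : (w i).adicCompletion L₀) ∈ U1 (x₀ i) (r i) →
      χ (RestrictedProduct.mulSingle B i g) = 1)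
  (VS : ∀ i, i ∈ S → IsSplit i → (Lp ℂ 2 (Adic.muV L₀ (w i)) →ₗᵢ[ℂ] Sp))
  (hVSψ : ∀ i (hi : i ∈ S) (hs : IsSplit i),
    VS i hi hs (a i • ballIndicator (Adic.muV L₀ (w i)) (x₀ i) (r i)) = φ)
  (hVS : ∀ i (hi : i ∈ S) (hs : IsSplit i), ∀ g : G i,
    D.ω (RestrictedProduct.mulSingle B i g) (VS i hi hs (a i • ballIndicator (Adic.muV L₀ (w i)) (x₀ i) (r i)))
      = VS i hi hs (dilationRep (Adic.muV L₀ (w i)) (ν i) (τ i hi hs g)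
          (a i • ballIndicator (Adic.muV L₀ (w i)) (x₀ i) (r i))))
  -- `v ∈ S` non-split: as #6–#9
  (hcpt : ∀ i ∈ S, ¬IsSplit i → CompactSpace (G i))
  (hiso : ∀ i ∈ S, ¬IsSplit i → ∀ g : G i, D.ω (RestrictedProduct.mulSingle B i g) φ
    = conj (((χ (RestrictedProduct.mulSingle B i g) : Circle) : ℂ)) • φ)

include hW hh hjA hj h𝓕 hχΓ hχVΓ P hφ hloc hχT' hlocχ hK hM hTS hT'S hw hBi hτUB hν hVUψ hVU
  hr hr0 hνS hχS hVSψ hVS hcpt hiso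

/-- **Lemma 4.2(b)'s conclusion `Θ(χ′) ≠ 0` for the genuine theta lift — split unramified places through the
IDENTIFICATION `τ_v : G_v ≃* L_{0,v}^×`, `τ_v(B_v) = 𝒪_v^×`.**  #9 `thetaLift_ne_zero_of_N31d_intertwiner` with
`ord`, `ϖ`, `ϖF`, `hϖF`, `ord_ϖ`, `ker_ord`, `tU`, `htU` DERIVED / CHOSEN (`ordOfIdent`, `unifOfIdent`,
`exists_isUniformizer`). -/
theorem thetaLift_ne_zero_of_N31d_ident [IsFiniteMeasure GU.μ]
    [IsFiniteMeasure (((haarDatum B hBc hBo S₀).μ).restrict 𝓕)]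
    (hk : Measurable (Function.uncurry (thetaFn D GU φ))) {Ck : ℝ} (hCk : 0 ≤ Ck)
    (hkC : ∀ q u, ‖thetaFn D GU φ q u‖ ≤ Ck) :
    PeterssonFubini.theta GU.μ (((haarDatum B hBc hBo S₀).μ).restrict 𝓕) hk
      (measurable_coe_char B hBo χ hχT' hlocχ) hCk hkC (norm_coe_char_le χ) ≠ 0 := by
  -- a uniformizer at every place (used only at the split places off `S`): pv07-g2 `exists_isUniformizer`
  choose ϖF hϖF using fun i : ι => exists_isUniformizer (F := (w i).adicCompletion L₀)
  exact thetaLift_ne_zero_of_N31d_intertwiner B hBc hBo S₀ hW hh D GU jA hjA j hj h𝓕 χ hχΓ hχVΓ P φ hφ hloc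
    hχT' hlocχ hK hM hTS hT'S L₀ w hw ν hBi (ordOfIdent S IsSplit L₀ w ϖF (fun i _ => hϖF i) τU)
    (unifOfIdent S IsSplit L₀ w ϖF τU) ϖF (fun i _ => hϖF i)
    (ordOfIdent_unif S IsSplit L₀ w ϖF (fun i _ => hϖF i) τU)
    (ordOfIdent_eq_one_iff B S IsSplit L₀ w ϖF (fun i _ => hϖF i) τU hτUB)
    hν (fun i hi hs => (τU i hi hs).toMonoidHom) (τU_unifOfIdent S IsSplit L₀ w ϖF τU) VU hVUψ
    (fun i hi hs g => by simpa only [MulEquiv.coe_toMonoidHom] using hVU i hi hs g)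
    τ x₀ r a hr hr0 hνS hχS VS hVSψ hVS hcpt hiso hk hCk hkC

end identEnd

end HodgeCM.PerL34.SplitShells

end
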